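import Literature.NumberTheory.LFunctions.NymanBeurlingRateProofs
import Literature.NumberTheory.LFunctions.MoebiusTwistSoundararajan
import Literature.NumberTheory.LFunctions.SoundararajanProp1
import Literature.NumberTheory.LFunctions.VTypicalOrdinates2008
import HarnessLib

/-!
# Balazard–de Roton 2010, Théorème 1 via the two deep inputs (A), (P12) — `BalazardDeRoton2010_thm1_holds_via_deep`

Topic `Literature/NumberTheory/LFunctions`. Everything here is PROVED. The named fact
`Literature.NumberTheory.LFunctions.BalazardDeRoton2010_thm1` (`NymanBeurlingRate.lean`): under the
Riemann Hypothesis, for every `δ > 0`, the distance `d_N²` of the Báez-Duarte / Nyman–Beurling criterion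
satisfies `d_N² ≪_δ (log log N)^{5/2+δ} (log N)^{−1/2}` (M. Balazard, A. de Roton, *Sur un critère de
Báez-Duarte pour l'hypothèse de Riemann*, Int. J. Number Theory 6 (2010), 883–903 = arXiv:0812.1689,
Théorème 1).

`BalazardDeRoton2010_thm1_of_deep` (`NymanBeurlingRateProofs.lean`) reduces it to two deep inputs:
(A) Soundararajan's bound `M(x) ≪ √x exp((log x)^{1/2}(log log x)^{5/2+δ})` under RH
(Balazard–de Roton 2008, Théorème 1) and (P12) Balazard–de Roton 2010, Prop. 12 (the twisted sums
`M_N(iτ)`), and `SoundContour.mertens_bound_of_engine`, `SoundContour.moebiusSum_twist_bound_of_engine`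
(`MertensBoundSoundararajan.lean`, `MoebiusTwistSoundararajan.lean`) reduce those to the three engine
statements of Soundararajan's method — Balazard–de Roton 2008, Props. 1, 18, 20 in the packaged shapes
`TypicalPointwise.Prop1With`, `TypicalLadder.Prop18With`, `TypicalCounting.Prop20With`. The engine is
proved under RH in `SoundararajanProp1.lean` (`SoundTest.prop1With_of_RH`: Soundararajan's main lemma via
the Guinand–Weil explicit formula, BR Props. 2, 5–8), `VTypicalOrdinates2008.lean`
(`prop18With_of_RH'`: Goldston–Gonek counts via Beurling–Selberg majorants, BR Props. 10–18) and
`SoundararajanTypicalBridge.lean` (`prop20With_of_RH`: BR Props. 19–20 via moments of prime Dirichlet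
polynomials). Combining gives a second, independent route to the fact (the discharge
`BalazardDeRoton2010_thm1_holds` itself lives in `NymanBeurlingRateEngine.lean`, via
`BalazardDeRoton2010_thm1_of_prop1`; this file goes through `BalazardDeRoton2010_thm1_of_deep`, i.e.
through the inputs (A) and (P12) explicitly, and is kept under a distinct name to avoid a duplicate
fully-qualified name in the tree).

## References

* [BalazardDeRoton2010] M. Balazard, A. de Roton, Int. J. Number Theory 6 (2010) 883–903
  (arXiv:0812.1689), Théorème 1. [cite: BalazardDeRoton2010, Théorème 1]
* [BalazardDeRoton2008] M. Balazard, A. de Roton, arXiv:0810.3587, Théorème 1, Props. 1, 18, 20.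
* K. Soundararajan, Partial sums of the Möbius function, J. reine angew. Math. 631 (2009) 141–152.
-/

noncomputable section

namespace Literature.NumberTheory.LFunctions

open BalazardDeRoton BaezDuarteOnlyIf

/-- **`BalazardDeRoton2010_thm1` via the deep inputs (A), (P12)** (Balazard–de Roton 2010, Théorème 1,
under RH as in the statement; a second route next to `BalazardDeRoton2010_thm1_holds` of
`NymanBeurlingRateEngine.lean`): from `BalazardDeRoton2010_thm1_of_deep`, the two engine reductions
`SoundContour.mertens_bound_of_engine` (input (A)) and `SoundContour.moebiusSum_twist_bound_of_engine`
(input (P12)), and the proved engine `SoundTest.prop1With_of_RH`, `prop18With_of_RH'`,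
`prop20With_of_RH`. [cite: BalazardDeRoton2010, Théorème 1] -/
theorem BalazardDeRoton2010_thm1_holds_via_deep : BalazardDeRoton2010_thm1 :=
  BalazardDeRoton2010_thm1_of_deep
    (fun hRH ↦ SoundContour.mertens_bound_of_engine hRH
      (fun δ hδ0 hδ1 ↦ by
        obtain ⟨D, T₀, -, h⟩ := SoundTest.prop1With_of_RH hRH hδ0 hδ1
        exact ⟨D, T₀, h⟩)
      (fun δ hδ0 hδ1 ↦ prop18With_of_RH' hRH hδ0 hδ1)
      (fun δ hδ0 hδ1 ↦ by
        obtain ⟨T₀, h⟩ := prop20With_of_RH hRH hδ0 hδ1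
        exact ⟨1, 12, T₀, h⟩))
    (fun hRH ↦ SoundContour.moebiusSum_twist_bound_of_engine hRH
      (fun δ hδ0 hδ1 ↦ by
        obtain ⟨D, T₀, -, h⟩ := SoundTest.prop1With_of_RH hRH hδ0 (by linarith)
        exact ⟨D, T₀, h⟩)
      (fun δ hδ0 hδ1 ↦ prop18With_of_RH' hRH hδ0 (by linarith))
      (fun δ hδ0 hδ1 ↦ by
        obtain ⟨T₀, h⟩ := prop20With_of_RH hRH hδ0 (by linarith)
        exact ⟨1, 12, T₀, h⟩))

end Literature.NumberTheory.LFunctions
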